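import Summits.QuantumFields.BalabanUV.Beta.EriceRemainderEnclosureHistoryAutonomyComparisonTowerChainFourLemmas

/-!
# EriceRemainderEnclosureHistoryAutonomyComparisonTowerRatioFourStep — (E67c) THE RATIO-4 STEP OF THE HYPERBOLIC CHAIN AS A LEMMA ABOUT FOUR REALS: given the
# budget line `(200∕259)x + (120∕109)s·Z ≤ 1∕2` of (E66a) at an age of ratio `s² = k⁻∕k ≤ 1∕4` whose predecessor carries `Z = Z_{k⁻} ≤ 71∕100`, the
# transported defect bound `8Zs²∕(2 − Z) = 2r·F(Z)` has the majorant `ē = 2u∕(1 − u)` (`u = sZ`) for which the chain condition `x(ē + 3∕4) < 1` and the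
# landing `ē∕2·(1 + x∕4) + x(1 + ē) ≤ F(x + u)(1 − x(3∕4 + ē))`, `F(Z) = 4Z∕(2 − Z)`, hold — (E66b)'s inner step, extracted so that (E67d) can use it at the
# inner ages of a tower with free ends; plus the bound `x + √r·y ≤ 71∕100` from the crude line

Cell `pub-balaban`, β-function sub-cell, BINDER row D4 «RemainderConst leaves for Bałaban's split» (`HOME/BINDER-OWNERS.md`; owner lineage `b2b-balaban-beta-an4`;
this file by co-owner #2 lineage `b2b-balaban-beta-d4-p2`, generation 59), β-FLOW TEAM duty (1), FREEZE (0) honoured (def-free; (E66a) `step_poly4` ∕ `cond_poly4`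
BY NAME).

HONEST FRAMING (page 1, verbatim and binding).  *"Discharging BetaPertH makes Bałaban's UV stability UNCONDITIONAL — a real constructive-QFT result; it is
NOT the continuum limit and NOT the Clay problem."*  THIS FILE DISCHARGES NOTHING OF THE KIND.  Lemmas about a few reals; nothing of Bałaban's is asserted.
Row D4 class UNCHANGED (critical-path width 0; instance 0∕1; D4 DISCHARGE NO DATE).  HONEST DEPENDENCY: continuum YM on T⁴ ⇐ BetaPertH ∧ nine spine estimates
(0/9 proved); BetaPertH ⇐ (D1) ∧ (D4) ∧ CAP+tail; G-an2-4 gates asym, D1 and NE2/3/4.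

WHAT IS PROVED ([folklore]; 0 `def`, 0 sorry).  **`ratio_four_step`**, `sum_le_of_crude_line`.
-/
noncomputable section

namespace Summit.QuantumFields.BalabanUV.Beta.EriceRemainderEnclosureHistoryAutonomyComparisonTowerRatioFourStep

open Summit.QuantumFields.BalabanUV.Beta.EriceRemainderEnclosureHistoryAutonomyComparisonTowerChainFourLemmas (step_poly4 cond_poly4)

/-- **THE RATIO-4 STEP OF THE HYPERBOLIC CHAIN.**  `x ∈ [0, 71∕100]` (the new load), `Z ∈ [0, 71∕100]` (the predecessor's young pressure), `s ∈ [0, 1∕2]`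
(`s² = k⁻∕k`), budget line `(200∕259)x + (120∕109)sZ ≤ 1∕2`.  Then with `ē = 2u∕(1 − u)`, `u = sZ`: `8Zs²∕(2 − Z) ≤ ē`, `x(ē + 3∕4) < 1`, and
`ē∕2·(1 + x∕4) + x(1 + ē) ≤ 4(x + u)∕(2 − (x + u))·(1 − x(3∕4 + ē))` ((E66a) `cond_poly4`, `step_poly4`). [folklore] -/
theorem ratio_four_step {x Z s : ℝ} (hx : 0 ≤ x) (hx1 : x ≤ 71 / 100) (hZ0 : 0 ≤ Z) (hZ1 : Z ≤ 71 / 100) (hs0 : 0 ≤ s) (hs2 : s ≤ 1 / 2)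
    (hl : x * (200 / 259) + s * Z * (120 / 109) ≤ 1 / 2) :
    ∃ e' : ℝ, 8 * Z * (s * s) / (2 - Z) ≤ e' ∧ x * (e' + 3 / 4) < 1 ∧
      e' / 2 * (1 + x / 4) + x * (1 + e') ≤ 4 * (x + s * Z) / (2 - (x + s * Z)) * (1 - x * (3 / 4 + e')) := by
  obtain ⟨u, hu_def⟩ : ∃ u : ℝ, u = s * Z := ⟨_, rfl⟩
  have hu0 : 0 ≤ u := by rw [hu_def]; exact mul_nonneg hs0 hZ0
  have hl' : x * (200 / 259) + u * (120 / 109) ≤ 1 / 2 := by rw [hu_def]; exact hl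
  have hu1 : u ≤ 109 / 120 * (1 / 2 - 200 / 259 * x) := by nlinarith
  have hul : u ≤ 109 / 240 := by nlinarith
  have hden1 : 0 < 1 - u := by linarith
  have hden2 : 0 < 2 - (x + u) := by linarith
  have hdenZ : 0 < 2 - Z := by linarith
  have h1u : 1 - u ≠ 0 := hden1.ne'
  have h2xu : 2 - (x + u) ≠ 0 := hden2.ne'
  have hkey : 4 * s * (1 - s * Z) ≤ 2 - Z := by
    have h1 : 0 ≤ 1 - 2 * s := by linarith
    have h2 : 0 ≤ 2 - Z * (1 + 2 * s) := by nlinarith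
    nlinarith [mul_nonneg h1 h2]
  have hE_le : 8 * Z * (s * s) / (2 - Z) ≤ 2 * u / (1 - u) := by
    rw [div_le_div_iff₀ hdenZ hden1, hu_def]
    have hsZ : 0 ≤ s * Z := mul_nonneg hs0 hZ0
    nlinarith [mul_le_mul_of_nonneg_left hkey hsZ]
  rw [← hu_def]
  refine ⟨2 * u / (1 - u), hE_le, ?_, ?_⟩
  · have hc := cond_poly4 hx hu0 hu1
    have : x * (2 * u / (1 - u) + 3 / 4) = x * (2 * u + 3 / 4 * (1 - u)) / (1 - u) := by
      field_simp
    rw [this, div_lt_one hden1]; exact hc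
  · have hP := step_poly4 hx hu0 hu1
    rw [show 2 * u / (1 - u) / 2 = u / (1 - u) by ring, ← sub_nonneg]
    have hid : 4 * (x + u) / (2 - (x + u)) * (1 - x * (3 / 4 + 2 * u / (1 - u))) -
        (u / (1 - u) * (1 + x / 4) + x * (1 + 2 * u / (1 - u))) =
        (4 * (x + u) * ((1 - u) * (1 - 3 / 4 * x) - 2 * u * x) - (u * (1 + x / 4) + x * (1 + u)) * (2 - x - u)) /
          ((2 - (x + u)) * (1 - u)) := by
      field_simp
      ring
    rw [hid]
    exact div_nonneg (by linarith [hP]) (mul_pos hden2 hden1).le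

/-- From the crude line `x√(1∕2) + y√(r∕(1+r)) ≤ 1∕2` (`x, y ≥ 0`, `0 ≤ r ≤ 1`): `x + √r·y ≤ 71∕100` (`1 = √2·√(1∕2)`, `√r ≤ √2·√(r∕(1+r))`). [folklore] -/
theorem sum_le_of_crude_line {x y r : ℝ} (hx : 0 ≤ x) (hy : 0 ≤ y) (hr0 : 0 ≤ r) (hr1 : r ≤ 1)
    (hl : x * Real.sqrt (1 / 2) + y * Real.sqrt (r / (1 + r)) ≤ 1 / 2) : x + Real.sqrt r * y ≤ 71 / 100 := by
  have hsq2 : Real.sqrt 2 * Real.sqrt (1 / 2) = 1 := by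
    rw [← Real.sqrt_mul (by norm_num)]; norm_num
  have hsq2' : Real.sqrt 2 ≤ 142 / 100 := by
    rw [show (142 : ℝ) / 100 = Real.sqrt ((142 / 100) ^ 2) by rw [Real.sqrt_sq (by norm_num)]]
    exact Real.sqrt_le_sqrt (by norm_num)
  have h1 : Real.sqrt r ≤ Real.sqrt 2 * Real.sqrt (r / (1 + r)) := by
    rw [← Real.sqrt_mul (by norm_num)]
    apply Real.sqrt_le_sqrt
    rw [mul_div_assoc', le_div_iff₀ (by positivity)]
    nlinarith
  have h2 : x = Real.sqrt 2 * (x * Real.sqrt (1 / 2)) := by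
    rw [mul_comm x, ← mul_assoc, hsq2, one_mul]
  have h3 : Real.sqrt r * y ≤ Real.sqrt 2 * (y * Real.sqrt (r / (1 + r))) := by
    have := mul_le_mul_of_nonneg_right h1 hy; linarith
  have h0 : 0 ≤ x * Real.sqrt (1 / 2) + y * Real.sqrt (r / (1 + r)) := by positivity
  calc x + Real.sqrt r * y
      ≤ Real.sqrt 2 * (x * Real.sqrt (1 / 2)) + Real.sqrt 2 * (y * Real.sqrt (r / (1 + r))) := by linarith
    _ = Real.sqrt 2 * (x * Real.sqrt (1 / 2) + y * Real.sqrt (r / (1 + r))) := by ring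
    _ ≤ 142 / 100 * (1 / 2) := mul_le_mul hsq2' hl h0 (by norm_num)
    _ = 71 / 100 := by norm_num

end Summit.QuantumFields.BalabanUV.Beta.EriceRemainderEnclosureHistoryAutonomyComparisonTowerRatioFourStep

end
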